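import Literature.NumberTheory.EllipticCurves.Kato2004.MemberHullCountInputs
import HarnessLib

/-!
# Kato 2004 (Astérisque 295), Lemma 13.10 (1) READ AT THE AUGMENTATION together with §5.5 / (4.7)
# (the cusp classes `δ(f,1,b(A))` generate `V_ℤ(f)`, Manin) and the modular-symbol dictionary of
# `EulerSystemValues.lean`: the `p`-adic valuation of the level-`0` MULTIPLIER `λ(0)` of the
# `(c,d,a(A))`-zeta class is a PINNED number — ONE hypothesis structure `MultiplierInputs` + ONE
# existence fact; KERNEL: with `MemberCountInputs` (Part 16) the order of `H²(ℤ[1/p], T_pW_K)` at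
# Kato's member is then pinned too

Topic `NumberTheory/EllipticCurves`, sub-directory `Kato2004` (namespace = path). Seat `bsd-potss-kmc`
(prover, cell `bsd-potss`, construction K9 / K8-t′), generation 10, part 17a; the cell's definition request
D-O6-2″ (the rank-ONE pin: items K9 19200 `WildRankOne` / KT 19984 `TameRankOne`).

## Why this file (the finding of memo v9 §1, recorded here because it motivates the one new field)

In the member packages `MemberHullInputs` (p439134) and `MemberCountInputs` (p448371) Kato's normalised
zeta element `z = z_γ⁰` of the reflexive hull and the multiplier `λ ∈ Λ` of Lemma 13.10 (1) (`j 𝐲 = λ•z`)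
are ABSTRACT fields, constrained by `λ(0) ≠ 0`, `F/Λz` torsion, the divisibility off `(p)` and the
counts.  These constraints do NOT determine `v_p λ(0)`: for any `g ∈ Λ` dividing `λ` with `g(0) ≠ 0`
and `p ∤ g`, the data `z'' := g•z`, `λ'' := λ/g`, `𝐇²'' := 𝐇² × Λ/(g)` (so that `𝐇²''[X] ≅ 𝐇²[X]`,
`#(𝐇²''/X𝐇²'') = #(𝐇²/X𝐇²)·#(ℤ_p/g(0))`, `ℓ_𝔮(𝐇²'') = ℓ_𝔮(𝐇²) + ℓ_𝔮(Λ/g) ≤ ℓ_𝔮(F/Λz'')`, `μ` unchanged)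
satisfy every field of both structures again, with `v_p λ''(0) = v_p λ(0) − v_p g(0)` — only the SUM
`v_p λ(0) + ord_p #(𝐇²/X𝐇²)` is pinned (by the exact count).  Consequently the rank-one nodes of the
cell's D-O6-2″ spec (HOME/bsd-potss-kmc/g9/REALISATION-SPEC-R1-PRRatio.md §3 F7: the Perrin-Riou ratio
`ℒ := log_ω(loc_p 𝐲₀)/(λ(0)·log_ω(x)²)` and the node `v_p(L′/(Ω·Reg)) = v_p ℒ`; and «Conj. 12.10 at the
member» `ord_p[A : Λ·ι(𝐲̄)] = v_p λ(0) + ord_p #(𝐇²/X𝐇²)`) are ILL-POSED over such packages — false as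
"for every package", manufacturable as "for some package".  What is missing is a PIN of `v_p λ(0)` in the
tree's vocabulary.  Lemma 13.10 (1) read at the augmentation supplies it through the tree's rational
modular symbols `ratMinusSymbol f` — this file.

## The printed statements (K. Kato, Astérisque 295 (2004); `[p. N]` = printed page; store key
`paper:doi-10-24033-ast-639`, PDF page `N − 115`) and the readings of record they enter through

* **Lemma 13.10 (1) [p. 230]** "Let `1 ≤ j ≤ k − 1`, `a, A ∈ ℤ`, `A ≥ 1`, and `c, d` be integers such
  that `(c, 6pA) = (d, 6pN) = 1`. Then `(_{c,d}z^{(p)}_{p^n}(f, k, j, a(A), prime(pA)))_n =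
  (∏_ℓ (1 − ā_ℓ ℓ^{−k}… σ_ℓ^{−1} + ε̄(ℓ)… σ_ℓ^{−2})) · (c²d² z_{γ₁}^{(p)} − c^u d² σ_c z_{γ₂}^{(p)} −
  c² d^v σ_d z_{γ₃}^{(p)} + c^u d^v σ_{cd} z_{γ₄}^{(p)})`, where `ℓ` ranges over all prime numbers `≠ p`
  which divide `A`, and `γ₁ = δ(f,j,a(A))`, `γ₂ = δ(f,j,ac(A))`, `γ₃ = δ(f,j,"a/d"(A))`,
  `γ₄ = δ(f,j,"ac/d"(A))`. Here "a/d" means any integer `b` such that `bd ≡ a mod A`, and "ac/d" means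
  any integer `b` such that `bd ≡ ac mod A`" — an equality in `𝐇¹(V_{F_λ}(f)) ⊗_Λ Q(Λ)`; for `k = 2`,
  `j = 1`: `(u, v) = (1, 1)` ((4.2.4) [p. 143]) and, by Ex. 13.3 [p. 225] (`P_ℓ(t) = 1 − a_ℓ ℓ^{1−r}t +
  ε(ℓ)ℓ^{k+1−2r}t²` at `k = 2`, `r = 1`), the Euler factor is `P_ℓ(ℓ⁻¹σ_ℓ⁻¹) = 1 − a_ℓ ℓ⁻¹σ_ℓ⁻¹ +
  ε(ℓ) ℓ⁻¹ σ_ℓ⁻²`, `ε(ℓ) = 0` for `ℓ ∣ N`, `1` otherwise.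
* **13.9 [pp. 229–230]** the definition of `z_γ^{(p)}`, its `F_λ`-linearity in `γ` (Thm. 12.5 (1)
  [p. 221]: "a unique `F_λ`-linear map `V_{F_λ}(f) → 𝐇¹(V_{F_λ}(f)); γ ↦ z_γ^{(p)}`") and
  "`z^{(p)}_{ι(γ)} = −σ_{−1}(z_γ^{(p)})`".
* **§5.5 [p. 156]** "`δ_{1,N}(2, 1, a(A)) ∈ H¹(Y₁(N)(ℂ), ℚ)` is the image of the class of the route
  `(0, ∞) → Y₁(N)(ℂ); y ↦ ν(A⁻¹(yi + a))` in `H₁(X₁(N)(ℂ), {cusps}, ℤ)`" (the path from the cusp `a/A`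
  to `∞`), **§4.7 [p. 145]** "the identification `H¹(Y(ℂ), Sym(ℋ¹)) ≅ H₁(X(ℂ), {cusps}, Sym(ℋ₁))` is by
  Poincaré duality", **§8.3 [p. 181]** "`V_{O_λ}(f)` … the `O_λ`-submodule of `V_{F_λ}(f)` generated by
  the image of `V_{k,ℤ_p}(Y₁(N))`", `V_{k,ℤ}(Y₁(N)) = H¹(Y₁(N)(ℂ), Sym^{k−2}_ℤ(ℋ¹))` ((4.5.1) [p. 144]);
  and Ju. I. Manin, Izv. 36 (1972), §1.5–1.6 (Thm. 1.6: the relative homology `H₁(X, {cusps}, ℤ)` of a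
  modular curve is generated by the classes of geodesics joining cusps) [Manin1972].
* The DICTIONARY of `EulerSystemValues.lean` (module docstring, DERIVED there in ≤ 3 lines each from
  (7.13.5)/(7.13.6) [p. 169], (7.6.1) [p. 166], §5.5, §4.7, p. 231 and the orientation of `F_∞`):
  `⟨δ(f,1,b(A)), per f⟩ = −modularSymbol f (b/A)`, `ι δ(route_r) = −δ(route_{−r})`, hence
  `⟨δ(f,1,b(A))⁺, per f⟩ = −minusSymbol f (b/A)`; and `minusSymbol f r = [r]⁻_f · Ω⁻_f · i` with
  `[r]⁻_f = ratMinusSymbol f r ∈ ℚ` (tree THEOREM `ratMinusSymbol_mul_minusPeriod_mul_I`, Manin–Drinfeld;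
  Mazur–Tate–Teitelbaum 1986 §I.8 [MazurTateTeitelbaum1986Invent]).
* The READING OF RECORD of the multiplier (docstring of `MemberHullInputs.lean`, p439134, reviewed ACCEPT;
  referee flag `Kato-12.6-13.10-14.16(2)-member-reading-reducible`): on `T = T_pW_K ≅ V_{ℤ_p}(f)(1)`,
  "by Lemma 13.10 (1) and 13.9, `𝐲 = λ · z_γ⁰` in `𝐇¹(V)⁰` with `γ ∈ V_ℚ(f)` any element whose `γ⁺` is a
  `ℤ_p`-basis of `T(−1)⁺`, `z_γ⁰ := e₀ z_γ^{(p)}` and the MULTIPLIER `λ = (p−1) · ∏_{ℓ∣A, ℓ≠p}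
  P_ℓ(ℓ⁻¹σ_ℓ⁻¹) · (c²d² b₁ − c d² b₂ σ_c − c² d b₃ σ_d + c d b₄ σ_{cd}) ∈ Λ`, `b_i ∈ ℤ_p` the
  coordinates `γ_i⁺ = b_i γ⁺`; its augmentation is `λ(0) = (p−1) · ∏_{ℓ∣A,ℓ≠p} L_ℓ(E,1)⁻¹ · b`, `b` the
  `γ⁺`-coordinate of `γ_* = c²d²γ₁ − cd²γ₂ − c²dγ₃ + cdγ₄`".

READING of this file (steps (m1)–(m4); `p` ODD, as everywhere in the member packages):
(m1) [§5.5 + §4.7 + Manin] the relative classes of the routes `{b/A → ∞}` (`b ∈ ℤ`, `A ≥ 1`) generate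
`H₁(X₁(N)(ℂ), {cusps}, ℤ) ≅ V_{2,ℤ}(Y₁(N))` (every class of a path between two cusps is a difference of
two such), so their images `δ(f,1,b(A))` generate the lattice `V_ℤ(f) :=` image of `V_{2,ℤ}(Y₁(N))` in
`V_ℚ(f)`, `V_{ℤ_p}(f) = ℤ_p ⊗ V_ℤ(f)` (§8.3), and — `V_ℤ(f)` being `ι`-stable and `2 ∈ ℤ_p^×` — the
`ℤ_p`-line `T(−1)⁺ = V_{ℤ_p}(f)⁺` is the `ℤ_p`-span of the `δ(f,1,b(A))⁺`.  (m2) [dictionary] the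
`ℂ`-linear functional `⟨·, per f⟩` is injective on the line `V_ℚ(f)⁺` and takes the value
`−i·Ω⁻_f·[b/A]⁻_f` on `δ(f,1,b(A))⁺`; hence the `ℤ`-span of `{[r]⁻_f : r ∈ ℚ}` is a finitely generated
(`V_ℤ(f)` is), non-zero (`V_ℚ(f)⁺ ≠ 0` is spanned by the `δ⁺`) subgroup of `ℚ`, i.e. `= ℤ·q⁻` for a unique
rational `q⁻ > 0`, and a generator `γ⁺` of `T(−1)⁺` may be taken with `⟨γ⁺, per f⟩ = ∓ i Ω⁻_f q⁻ · u`,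
`u ∈ ℤ_p^×`.  (m3) the coordinates are therefore `b_i = ± [a_i/A]⁻_f / (q⁻ u)` for the four cusps
`a_i/A ∈ {a/A, ac/A, ad′/A, acd′/A}` (`dd′ ≡ 1 mod A`), and
`b = ± (c²d² [a/A]⁻ − cd² [ac/A]⁻ − c²d [ad′/A]⁻ + cd [acd′/A]⁻)/(q⁻ u) = ± R⁻/(q⁻ u)` with
`R⁻ := ratCuspFactor f true c d a A d′` below — the RATIONAL four-cusp factor of Thm. 6.6 (1) at the
trivial character, i.e. `cuspFactor f true 1 c d a A d′` of the value law (C5) of `ZetaBody` (kernel lemma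
`cuspFactor_one_eq_ratCuspFactor`; parity cross-over (P1) of `EulerSystemValues.lean`: the trivial, even,
character sees the MINUS symbols).  (m4) [13.10 (1) at the augmentation `σ ↦ 1`, `(p−1) ∈ ℤ_p^×`]
  **`v_p λ(0) = Σ_{ℓ ∣ A, ℓ ≠ p} v_p P_ℓ(ℓ⁻¹) + v_p R⁻ − v_p q⁻`**, `P_ℓ(ℓ⁻¹) = 1 − a_ℓ/ℓ + ε(ℓ)/ℓ =
`eulerFactorAtOne W N ℓ` below (`a_ℓ = a_ℓ(W)` by `IsNewformOf`), all three terms PINNED rationals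
(`λ(0) ≠ 0 ⟺ R⁻ ≠ 0`, the Euler factors at `s = 1` being non-zero: `|a_ℓ| ≤ 2√ℓ < ℓ + 1`, resp.
`a_ℓ ∈ {0, ±1}` for `ℓ ∣ N`).  Changing the admissible `γ` (by `ℤ_p^×`) changes `λ` by a unit: `v_p λ(0)`
is an invariant of the pinned class `𝐲`, and (m4) computes it.

## What this pins and what it does not

PINNED by the new field: `v_p λ(0)` (and hence, with Part 16's exact count, `ord_p #(𝐇²/X𝐇²) =
ord_p #H²(ℤ[1/p], T_pW_K)` at Kato's member — kernel theorem `padicValNat_coinvariants_H2_eq` below; in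
rank `0` this is the only new consequence: «Conj. 12.10 at the member» stays equivalent to `BSD(E,p)` at
the member granted the exact count, as recorded in memo v8 V76).  In analytic rank ONE it is the first of
the three pins under which the Perrin-Riou node and the «12.10 at the trivial character» node become
CLOSED statements of fixed strength (memo v9 §2: the other two are the position of `𝐲₀` relative to the
compact Selmer module `H¹_f(ℚ, T_pW_K) ⊂ H¹(ℚ, T_pW_K)` and `v_p log_ω(x)` of a Mordell–Weil generator
through the tree's `padicLogPoint`).  NOT pinned, not claimed: `λ` itself as a power series, `z_γ⁰`,
`u`, the sign; nothing at `p = 2`; no value of any modular symbol is asserted.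

## References

* K. Kato, Astérisque 295 (2004): (4.2.4) (p. 143), (4.5.1) (p. 144), §4.7 (p. 145), §5.5 (p. 156),
  §6.3 (pp. 161–162), Thm. 6.6 (1) (p. 163), (7.13.5)–(7.13.6) (p. 169), §8.3 (p. 181), Thm. 12.5 (1)
  (p. 221), Ex. 13.3 (p. 225), 13.9 and Lemma 13.10 (1) (pp. 229–230) — pp. 229–230 re-read 2026-08-26
  from the store text `paper:doi-10-24033-ast-639` (p0114–p0115). [Kato2004Asterisque]
* Ju. I. Manin, *Parabolic points and zeta functions of modular curves*, Izv. AN SSSR 36 (1972),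
  §1.5–1.6 (Thm. 1.6) and Cor. 3.6. [Manin1972]
* B. Mazur, J. Tate, J. Teitelbaum, Invent. Math. 84 (1986), §I.8. [MazurTateTeitelbaum1986Invent]
* Tree: `Kato2004/MemberHullInputs.lean` (the multiplier reading, field `lam`), `Kato2004/MemberHullCountInputs.lean`
  (`MemberCountInputs.exactCount`), `Kato2004/EulerSystemValues.lean` (`cuspFactor`, dictionary, (P1)),
  `PAdicLFunctionMinus.lean` (`ratMinusSymbol`, `ratMinusSymbol_mul_minusPeriod_mul_I`),
  `PAdicLFunction.lean` (`ratPlusSymbol`).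
-/

noncomputable section

open scoped NumberField TensorProduct
open Field IsDedekindDomain CongruenceSubgroup
open Literature.NumberTheory.GaloisRepresentations
open Literature.NumberTheory.EllipticCurves Literature.NumberTheory.EllipticCurves.ModularForms
open Literature.NumberTheory.EllipticCurves.Kato2004
open Literature.NumberTheory.EllipticCurves.Kato2004.EulerSystemValues Rat.HeightOneSpectrum
open Literature.NumberTheory.EllipticCurves.IwasawaAlgebra

namespace Literature.NumberTheory.EllipticCurves.Kato2004

/-! ## The two pinned rational quantities -/

section Rational

variable {N : ℕ} (f : CuspForm (Gamma0 N) 2)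

/-- The RATIONAL four-cusp factor of Thm. 6.6 (1) at the TRIVIAL character (`χ̄ = 1`), through the
tree's rational modular symbols with the parity cross-over (P1) of `EulerSystemValues.lean`
(`even = true ↦ [·]⁻ = ratMinusSymbol`, `even = false ↦ [·]⁺ = ratPlusSymbol`):
`R^∓ = c²d²[a/A]^∓ − cd²[ac/A]^∓ − c²d[ad′/A]^∓ + cd[acd′/A]^∓ ∈ ℚ` (`dd′ ≡ 1 mod A`; Lemma 13.10 (1):
"a/d", "ac/d").  Its cast to `ℂ` is `cuspFactor f even 1 c d a A d′` (`cuspFactor_one_eq_ratCuspFactor`).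
[cite: Kato2004Asterisque, Thm. 6.6 (1) (p. 163), Lemma 13.10 (1) (p. 230)] -/
def ratCuspFactor (even : Bool) (c d a : ℤ) (A : ℕ) (d' : ℤ) : ℚ :=
  let sym : ℚ → ℚ := if even then ratMinusSymbol f else ratPlusSymbol f
  ((c : ℚ) ^ 2 * (d : ℚ) ^ 2) * sym ((a : ℚ) / A)
    - ((c : ℚ) * (d : ℚ) ^ 2) * sym ((a * c : ℚ) / A)
    - ((c : ℚ) ^ 2 * (d : ℚ)) * sym ((a * d' : ℚ) / A)
    + ((c : ℚ) * (d : ℚ)) * sym ((a * c * d' : ℚ) / A)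

/-- At the trivial character (`χ̄ = 1`) Kato's complex four-cusp factor of the value law (C5) of `ZetaBody`
IS the rational one: `cuspFactor f even 1 c d a A d′ = (ratCuspFactor f even c d a A d′ : ℂ)`.
Kernel (unfolding and `push_cast`); nothing assumed. [cite: Kato2004Asterisque, Thm. 6.6 (1) (p. 163)] -/
theorem cuspFactor_one_eq_ratCuspFactor (even : Bool) (c d a : ℤ) (A : ℕ) (d' : ℤ) :
    cuspFactor f even (fun _ ↦ (1 : ℂ)) c d a A d' = (ratCuspFactor f even c d a A d' : ℂ) := by
  cases even <;> simp only [cuspFactor, ratCuspFactor] <;> push_cast <;> ring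

end Rational

section Euler

variable (W : WeierstrassCurve ℚ)

/-- The Euler factor of `L(W, s)` at `ℓ` evaluated at `s = 1`, for the form of level `N`:
`P_ℓ(ℓ⁻¹) = 1 − a_ℓ(W)/ℓ + ε(ℓ)/ℓ` with `ε(ℓ) = 0` for `ℓ ∣ N` and `1` otherwise (Kato Ex. 13.3 at
`k = 2`, `r = 1`: `P_ℓ(t) = 1 − a_ℓ t + ε(ℓ) ℓ t²`; `a_ℓ(W) = W.LFunction ℓ`, the Dirichlet coefficient,
`= a_ℓ(f)` under `IsNewformOf W f`).  It equals `L_ℓ(W,1)⁻¹ = #Ẽ_ns(𝔽_ℓ)/ℓ` and is never `0`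
(`|a_ℓ| ≤ 2√ℓ`; `a_ℓ ∈ {0, ±1}` at `ℓ ∣ N`) — not used here.
[cite: Kato2004Asterisque, Ex. 13.3 (p. 225), Lemma 13.10 (1) (p. 230)] -/
def eulerFactorAtOne (N ℓ : ℕ) : ℚ :=
  1 - (W.LFunction ℓ : ℚ) / ℓ + (if ℓ ∣ N then 0 else (1 : ℚ) / ℓ)

end Euler

/-! ## The package: Lemma 13.10 (1) at the augmentation, pinned through the minus symbols -/

section Package

variable (W : WeierstrassCurve ℚ) {N : ℕ} (f : CuspForm (Gamma0 N) 2) (p : ℕ) [Fact p.Prime]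
  (c d a : ℤ) (A : ℕ) (lam : IwasawaAlgebra p)

/-- **The multiplier pin — hypothesis structure (the reading (m1)–(m4) of the module docstring; nothing
asserted).**  For the newform `f` of `W` (level `N`), an odd prime `p`, an admissible datum `(c, d, a, A)`
of Ex. 13.3 and a power series `λ ∈ Λ = ℤ_p⟦X⟧` (intended: the field `lam` of a member package, the
multiplier of Lemma 13.10 (1) with `j 𝐲 = λ • z_γ⁰`): the generator `q⁻ > 0` of the lattice of minus
symbols of `f` ((m1)–(m2): Manin's generation of `H₁(X₁(N), {cusps}, ℤ)` by cusp-to-`∞` routes + the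
period dictionary), an inverse `d′` of `d` modulo `A` (Lemma 13.10 (1): "a/d"), and THE PIN (m4):
`v_p λ(0) = Σ_{ℓ ∣ A, ℓ ≠ p} v_p P_ℓ(ℓ⁻¹) + v_p R⁻ − v_p q⁻` with `R⁻ = ratCuspFactor f true c d a A d′ ≠ 0`.
The quantities `q⁻`, `R⁻`, `P_ℓ(ℓ⁻¹)` are pinned rationals of the tree (`ratMinusSymbol f`, `W.LFunction`);
only `λ` is a parameter.
[cite: Kato2004Asterisque, Lemma 13.10 (1) (p. 230), 13.9 (pp. 229–230), Thm. 12.5 (1) (p. 221), §5.5 (p. 156), §4.7 (p. 145), §8.3 (p. 181), Ex. 13.3 (p. 225), Thm. 6.6 (1) (p. 163)]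
[cite: Manin1972, §1.5–1.6 (Thm. 1.6)] [cite: MazurTateTeitelbaum1986Invent, §I.8] -/
structure MultiplierInputs : Type where
  /-- (m2) the positive generator `q⁻` of the `ℤ`-span of the minus symbols `{[r]⁻_f : r ∈ ℚ}` … -/
  q : ℚ
  /-- … positive … -/
  q_pos : 0 < q
  /-- … and generating: `ℤ·{[r]⁻_f : r ∈ ℚ} = ℤ·q⁻` (finitely generated by Manin's theorem — the cusp
  routes generate `H₁(X₁(N), {cusps}, ℤ)` — and non-zero since `V_ℚ(f)⁺ ≠ 0`). -/
  closure_range_ratMinusSymbol :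
    AddSubgroup.closure (Set.range (ratMinusSymbol f)) = AddSubgroup.zmultiples q
  /-- Lemma 13.10 (1): an integer `d′` with `d d′ ≡ 1 mod A` ("a/d" `= a d′`, "ac/d" `= a c d′`). -/
  d' : ℤ
  /-- `d d′ ≡ 1 (mod A)`. -/
  d_mul_d' : (d : ℤ) * d' ≡ 1 [ZMOD (A : ℤ)]
  /-- (m3) the rational four-cusp factor at the trivial character is non-zero (`⟺ λ(0) ≠ 0`, the datum
  being chosen with non-vanishing level-`0` multiplier, as in `exists_memberHullInputs`). -/
  ratCuspFactor_ne_zero : ratCuspFactor f true c d a A d' ≠ 0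
  /-- (m4) **THE PIN**: `v_p λ(0) = Σ_{ℓ ∣ A, ℓ ≠ p} v_p P_ℓ(ℓ⁻¹) + v_p R⁻ − v_p q⁻`
  (Lemma 13.10 (1) at `σ ↦ 1`; `(p − 1) ∈ ℤ_p^×`; the coordinates `b_i = ±[a_i/A]⁻/(q⁻u)`, `u ∈ ℤ_p^×`). -/
  valuation_constantCoeff_eq :
    (((PowerSeries.constantCoeff lam).valuation : ℕ) : ℤ) =
      (∑ ℓ ∈ (A.primeFactors.erase p), padicValRat p (eulerFactorAtOne W N ℓ)) +
        padicValRat p (ratCuspFactor f true c d a A d') - padicValRat p q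

end Package

/-! ## Kernel consequences -/

section Pin

variable {W : WeierstrassCurve ℚ} {p : ℕ} [Fact p.Prime]
  {N : ℕ} {f : CuspForm (Gamma0 N) 2} {c d a : ℤ} {A : ℕ}

/-- The pinned value of `v_p λ(0)` for a member package `P` (abbreviation of the right-hand side of the
pin, for statements). [cite: Kato2004Asterisque, Lemma 13.10 (1) (p. 230)] -/
def MultiplierInputs.pinnedValuation {lam : IwasawaAlgebra p}
    (M : MultiplierInputs W f p c d a A lam) : ℤ :=
  (∑ ℓ ∈ (A.primeFactors.erase p), padicValRat p (eulerFactorAtOne W N ℓ)) +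
    padicValRat p (ratCuspFactor f true c d a A M.d') - padicValRat p M.q

/-- Unfolding: the pin says `v_p λ(0) = M.pinnedValuation`. Kernel. [cite: Kato2004Asterisque, Lemma 13.10 (1) (p. 230)] -/
theorem MultiplierInputs.valuation_eq_pinnedValuation {lam : IwasawaAlgebra p}
    (M : MultiplierInputs W f p c d a A lam) :
    (((PowerSeries.constantCoeff lam).valuation : ℕ) : ℤ) = M.pinnedValuation :=
  M.valuation_constantCoeff_eq

end Pin

section Kernel

variable {W : WeierstrassCurve ℚ} [W.IsElliptic] {p : ℕ} [Fact p.Prime]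
  [ContinuousSMul ℤ_[p] (W.tateModule p)] {κ : ZpExtension ℚ p} {γ : absoluteGaloisGroup ℚ}
  {I : IwasawaH1Data W p κ γ} {y : I.H} {P : MemberHullInputs W p κ γ I y}
  {N : ℕ} {f : CuspForm (Gamma0 N) 2} {c d a : ℤ} {A : ℕ}

/-- **With the multiplier pinned, Part 16's exact count pins the order of `H²(ℤ[1/p], T_pW)` at Kato's
member** (`= 𝐇²/X𝐇²` by (14.14.2)): `ord_p #(𝐇²/X𝐇²) = ord_p #Ш(W)[p^∞] + v_p Tam(W) + ord_p[A : Λ·ι(𝐲̄)]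
− ord_p(L(W,1)/Ω(W)) − (Σ_ℓ v_p P_ℓ(ℓ⁻¹) + v_p R⁻ − v_p q⁻) − 2·ord_p #W(ℚ)_tors` — every term on the right
is a pinned quantity of the tree.  Kernel (`MemberCountInputs.exactCount` + the pin); nothing else assumed.
[cite: Kato2004Asterisque, proof of Prop. 14.16 (pp. 244–245), §14.14 (14.14.2) (p. 243), Lemma 13.10 (1) (p. 230)] -/
theorem MemberCountInputs.padicValNat_coinvariants_H2_eq (C : MemberCountInputs W p κ γ I y P)
    (M : MultiplierInputs W f p c d a A P.lam) :
    ∃ q : ℚ, W.entireLFunction 1 / (W.realPeriodRat : ℂ) = (q : ℂ) ∧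
      (padicValNat p (Nat.card (coinvariants p P.H2)) : ℤ) =
        (padicValNat p (Nat.card (AddCommGroup.primaryComponent W.sha p)) : ℤ) +
          padicValNat p W.tamagawaProduct +
          padicValNat p (Nat.card (P.A ⧸ (IwasawaAlgebra p) ∙ P.ι (Submodule.Quotient.mk y))) -
          padicValRat p q - M.pinnedValuation - 2 * (padicValNat p W.torsionOrder : ℤ) := by
  obtain ⟨q, hq, hcount⟩ := C.exactCount
  have hpin := M.valuation_eq_pinnedValuation
  refine ⟨q, hq, ?_⟩
  linarith

/-- **«Kato's Conj. 12.10 at the member» in pinned currency is the BSD identity at the member** (rank `0`):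
granted the exact count and the multiplier pin, `v_p λ(0)_pinned + ord_p #(𝐇²/X𝐇²) = ord_p[A : Λ·ι(𝐲̄)]`
holds iff `ord_p #Ш(W)[p^∞] + v_p Tam(W) = ord_p(L(W,1)/Ω(W)) + 2·ord_p #W(ℚ)_tors` — the pin does NOT
separate the two in rank `0` (memo v8 V76 / v9 §1: circular as an input); recorded so that no reader
mistakes the pin for new rank-`0` content.  Kernel restatement of
`MemberCountInputs.index_eq_iff_sha_add_tamagawa_eq`. [cite: Kato2004Asterisque, Conj. 12.10 (p. 224), Prop. 14.16 (2) (p. 244)] -/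
theorem MemberCountInputs.pinnedIndex_eq_iff (C : MemberCountInputs W p κ γ I y P)
    (M : MultiplierInputs W f p c d a A P.lam) {q : ℚ}
    (hq : W.entireLFunction 1 / (W.realPeriodRat : ℂ) = (q : ℂ)) :
    (M.pinnedValuation + padicValNat p (Nat.card (coinvariants p P.H2)) =
        padicValNat p (Nat.card (P.A ⧸ (IwasawaAlgebra p) ∙ P.ι (Submodule.Quotient.mk y)))) ↔
      ((padicValNat p (Nat.card (AddCommGroup.primaryComponent W.sha p)) : ℤ) +
          padicValNat p W.tamagawaProduct =
        padicValRat p q + 2 * (padicValNat p W.torsionOrder : ℤ)) := by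
  rw [← M.valuation_eq_pinnedValuation]
  exact C.index_eq_iff_sha_add_tamagawa_eq hq

end Kernel

/-! ## The named fact: the member packages exist TOGETHER WITH the multiplier pin -/

/-- **Kato 2004, Lemma 13.10 (1) at the augmentation with §5.5 / §4.7 / §8.3 (Manin's generation of
`V_ℤ(f)` by the cusp classes) and the period dictionary (Mazur–Tate–Teitelbaum §I.8 rational symbols), AT
KATO'S LATTICE `T = V_{ℤ_p}(f)(1)`, on top of the member packages of `exists_memberHullCountInputs`: the
multiplier of THE lift `𝐲` is pinned.**  Same quantifier prefix as `exists_memberHullCountInputs`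
(globally minimal `W/ℚ`, `p ≠ 2` ADDITIVE, POTENTIALLY GOOD, `W[p]` REDUCIBLE, `L(W,1) ≠ 0`, `Ш(W)` finite
⟹ a globally minimal `ℚ`-isogenous member `W_K`, a `ZetaBody` datum for ONE admissible `(c,d,a,A)`, and
for every cyclotomic `κ`, `γ`, `I : IwasawaH1Data W_K p κ γ` and THE lift `𝐲`); conclusion: a package
`P : MemberHullInputs W_K p κ γ I 𝐲` with `MemberCountInputs … P` AND `MultiplierInputs W_K f p c d a A P.lam`
(the SAME `f`, `c`, `d`, `a`, `A` as the `ZetaBody` datum).  It implies `exists_memberHullCountInputs`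
(`exists_memberHullCountInputs_of_multiplier`).  A CONSTRUCTION fact (D-0014): its content beyond
p448371 is the transcription (m1)–(m4) of the module docstring — that Kato's multiplier for the class of
the admissible datum has the displayed valuation at `X = 0`; weaker than print (the power series `λ`, the
sign and the unit `u` are forgotten), never stronger.  Named fact; nothing asserted; no `_holds` expected
(size XL, as its base).  Flag for the referee: `Kato-13.10(1)-augmentation-minus-symbol-lattice-member`
(non-verbatim steps: (m1) Manin generation ⟹ `T(−1)⁺ = ℤ_p·{δ(f,1,b(A))⁺}`; (m2)–(m3) coordinates through
the injective period functional and the dictionary line `⟨δ⁺, per f⟩ = −minusSymbol`; `(p−1) ∈ ℤ_p^×`).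
[cite: Kato2004Asterisque, Lemma 13.10 (1) (p. 230), 13.9 (pp. 229–230), Thm. 12.5 (1) (p. 221), Thm. 12.6 (p. 222), §5.5 (p. 156), §4.7 (p. 145), (4.5.1) (p. 144), §8.3 (p. 181), Ex. 13.3 (p. 225), Thm. 6.6 (1) (p. 163), (7.13.5)–(7.13.6) (p. 169), proof of Prop. 14.16 (pp. 244–245)]
[cite: Manin1972, §1.5–1.6 (Thm. 1.6) and Cor. 3.6] [cite: MazurTateTeitelbaum1986Invent, §I.8]
[cite: GreenbergLNM1716, §3 and appendix to §4] [cite: CoatesLNM1716, Lemma 3.8 (p. 34)]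
[cite: Kim2022StructureSelmer, §3.2.3 (PDF p. 16)] [cite: Wuthrich2014, Lemma 12 (p. 395), Lemma 14 (p. 396)] -/
def exists_memberHullMultiplierInputs : Prop :=
  ∀ (W : WeierstrassCurve ℚ) [W.IsElliptic] [W.IsGloballyMinimal] (p : ℕ) [Fact p.Prime]
    (hp : p ≠ 2),
    ¬ W.HasGoodReductionAtPrime p → ¬ W.HasMultiplicativeReductionAtPrime p →
    0 ≤ padicValRat p W.j →
    ¬ W.HasIrreducibleModPGaloisRep p →
    W.entireLFunction 1 ≠ 0 → Finite W.sha →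
    ∃ (W' : WeierstrassCurve ℚ) (_ : W'.IsElliptic) (_ : W'.IsGloballyMinimal),
      WeierstrassCurve.IsIsogenous W W' ∧
      ∀ [ContinuousSMul ℤ_[p] (W'.tateModule p)] [Module.Free ℤ_[p] (W'.tateModule p)]
        [Module.Finite ℤ_[p] (W'.tateModule p)],
      ∀ {N : ℕ} [NeZero N] (f : CuspForm (Gamma0 N) 2), IsNewformOf W f →
      ∀ (ι : (m : ℕ) → (CyclotomicField m ℚ →+* ℂ)),
      ∃ (κ' : ℝ) (Λ' : ∀ (k : ℕ) (r : Finset (HeightOneSpectrum (𝓞 ℚ))),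
          H1 (tateRep W' p) (cycSubgroup p k r) →ₗ[ℤ_[p]] ℚ_[p] ⊗[ℚ] CyclotomicField (cycLevel p k r) ℚ)
        (c d a : ℤ) (A : ℕ)
        (z : ∀ (k : ℕ) (r : (cyclotomicLevelsRat p (badPlaces c d A N)).Ideals),
          H1 (tateRep W' p) ((cyclotomicLevelsRat p (badPlaces c d A N)).level k r.1))
        (x : ∀ (k : ℕ) (r : (cyclotomicLevelsRat p (badPlaces c d A N)).Ideals),
          CyclotomicField (cycLevel p k r.1) ℚ),
        κ' ≠ 0 ∧ 0 < A ∧ Int.gcd c (6 * p * A) = 1 ∧ Int.gcd d (6 * p * N) = 1 ∧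
        ZetaBody W' p f ι κ' Λ' c d a A z x ∧
        ∀ (κ : ZpExtension ℚ p) (γ : absoluteGaloisGroup ℚ) (hκ : κ.IsCyclotomic),
          κ.IsTopGenerator γ →
          ∀ (I : IwasawaH1Data W' p κ γ) (y : I.H),
            (∀ n : ℕ, I.proj n y = levelToLayer W' p hκ hp (badPlaces c d A N) n
              (z (n + 1) (cyclotomicLevelsRat p (badPlaces c d A N)).idealOne)) →
            ∃ P : MemberHullInputs W' p κ γ I y,
              Nonempty (MemberCountInputs W' p κ γ I y P) ∧
                Nonempty (MultiplierInputs W' f p c d a A P.lam)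

/-- The pinned fact implies the sharp fact `exists_memberHullCountInputs` (forget the pin).
Kernel; nothing else assumed. [cite: Kato2004Asterisque, Lemma 13.10 (1) (p. 230), Prop. 14.16 (2) (p. 244)] -/
theorem exists_memberHullCountInputs_of_multiplier (h : exists_memberHullMultiplierInputs) :
    exists_memberHullCountInputs := by
  intro W _ _ p _ hp hng hnm hj hred hL hfin
  obtain ⟨W', hE', hM', hiso, hrest⟩ := h W p hp hng hnm hj hred hL hfin
  refine ⟨W', hE', hM', hiso, ?_⟩
  intro _ _ _ N _ f hf ι
  obtain ⟨κ', Λ', c, d, a, A, z, x, h1, h2, h3, h4, hbody, hpack⟩ := hrest f hf ι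
  refine ⟨κ', Λ', c, d, a, A, z, x, h1, h2, h3, h4, hbody, ?_⟩
  intro κ γ hκ hγ I y hy
  obtain ⟨P, hC, -⟩ := hpack κ γ hκ hγ I y hy
  exact ⟨P, hC⟩

-- TODO(general form): Lemma 13.10 (1) as an identity of POWER SERIES (`λ` itself, not only `v_p λ(0)`)
-- once `V_ℤ(f)`, the cusp classes `δ(f,1,b(A))` and `z_γ^{(p)}` are objects of the tree; Lemma 13.10 (2)
-- (`ξ ∈ SL₂(ℤ)`); weight `k ≥ 2`; and the rank-ONE member package carrying the same pin (seat kmc memo v9 §2).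

end Literature.NumberTheory.EllipticCurves.Kato2004

end
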